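import Mathlib.Analysis.SpecialFunctions.Exp
import Mathlib.Analysis.SpecialFunctions.Pow.Real
import Mathlib.Analysis.Real.Pi.Bounds
import Mathlib.Analysis.Complex.ExponentialBounds
import HarnessLib

/-!
# Negative side of K2Q `QuasiStaticSolenoidalCellTensorQ` (stmt-AnomalousDissipation-19072): the frozen drain constant of a
# window against the realised Taylor part — real arithmetic (helper, `--supports stmt-AnomalousDissipation-19072`)

Summits-side helper file (everything proved; no definitions, no named facts).  `drain_const_le`: with `|ℓ| = 1`, `κ = ν/n²`,
`ε = δ/8`, the constant `d` of `galerkin_floor_cell` (written out literally) is at most `(1 + δ/2)·Δ₁`,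
`Δ₁ = 8π²qP(1−4ρ/3)c₀/(ν²n²)`, once `n ≥ 16/δ`, `π⁴c₀δn ≥ 3`, `162k²q²P² ≤ π⁴c₀δ²ν²n²`, `8π²qP ≤ n²`
(`cF ≤ k/n` the exchange constant, `η ≤ 1` the cone).  Auxiliary: `inv_sq_one_sub_le` (`1/(1−1/n)² ≤ 1 + 3/n`, `n ≥ 5`).
This is NOT a proof of anomalous dissipation, and by itself not of `¬ K2Q`.
-/

set_option linter.dupNamespace false

noncomputable section

namespace Summit.AnomalousDissipation.AnomalousDissipation.Theorems.QuasiStaticSolenoidalCellTensorQ.Negative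

/-- `1/(1 − 1/n)² ≤ 1 + 3/n` for `n ≥ 5`. -/
theorem inv_sq_one_sub_le {n : ℝ} (hn : 5 ≤ n) : 1 / (1 - 1 / n) ^ 2 ≤ 1 + 3 / n := by
  have hn0 : 0 < n := by linarith
  have hX : 0 < 1 - 1 / n := by rw [sub_pos, div_lt_one hn0]; linarith
  rw [div_le_iff₀ (pow_pos hX 2)]
  have e : (1 + 3 / n) * (1 - 1 / n) ^ 2 = 1 + (n ^ 2 - 5 * n + 3) / n ^ 3 := by field_simp; ring
  rw [e]
  have : 0 ≤ (n ^ 2 - 5 * n + 3) / n ^ 3 := div_nonneg (by nlinarith) (by positivity)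
  linarith

set_option maxHeartbeats 1600000 in
/-- **The frozen drain constant against the realised Taylor part.** See the module docstring. -/
theorem drain_const_le {P ρ c₀ ν δ cF η k n q : ℝ} (hP : 0 < P) (hρ : ρ ≤ 3 / 4) (hc₀ : 0 < c₀) (hν : 0 < ν)
    (hδ0 : 0 < δ) (hδ1 : δ ≤ 1) (hq : 0 ≤ q) (hcF0 : 0 ≤ cF) (hcF : cF ≤ k / n)
    (hη0 : 0 ≤ η) (hη1 : η ≤ 1) (hn1 : 16 / δ ≤ n) (hn2 : 3 ≤ Real.pi ^ 4 * c₀ * δ * n)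
    (hn3 : 162 * k ^ 2 * q ^ 2 * P ^ 2 ≤ Real.pi ^ 4 * c₀ * δ ^ 2 * ν ^ 2 * n ^ 2) (hn4 : 8 * Real.pi ^ 2 * q * P ≤ n ^ 2) :
    4 * (q * (1 - 4 * ρ / 3)) * (P / ν * 1 / (8 * Real.pi ^ 2 * (ν / n ^ 2) * n ^ 4 * (1 - 1 / n) ^ 2)) *
        ((1 + δ / 8) * (32 * Real.pi ^ 4 * c₀ + 3 * (1 / n)) / 2 +
          (1 + 1 / (δ / 8)) * (Real.exp (ν / n ^ 2 * (4 * Real.pi ^ 2 * 1) * (q * (P / ν))) ^ 2 * cF ^ 2 * (1 + η) *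
            (q * (P / ν)) ^ 2)) ≤
      (1 + δ / 2) * (8 * Real.pi ^ 2 * q * P / n ^ 2 * ((1 - 4 * ρ / 3) * c₀) / ν ^ 2) := by
  have hπ := Real.pi_gt_three
  have hπ0 : 0 < Real.pi := Real.pi_pos
  have hπ4 : 81 ≤ Real.pi ^ 4 := by nlinarith [pow_le_pow_left₀ (by norm_num : (0:ℝ) ≤ 3) hπ.le 4]
  have hn16 : 16 ≤ n := le_trans (by rw [le_div_iff₀ hδ0]; nlinarith) hn1
  have hn0 : 0 < n := by linarith
  have hX0 : 0 < 1 - 1 / n := by rw [sub_pos, div_lt_one hn0]; linarith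
  have hρ' : 0 ≤ 1 - 4 * ρ / 3 := by linarith
  -- the exponential factor
  set e : ℝ := Real.exp (ν / n ^ 2 * (4 * Real.pi ^ 2 * 1) * (q * (P / ν))) with hedef
  have he0 : 0 ≤ e := (Real.exp_pos _).le
  have he3 : e ≤ 3 := by
    have h1 : ν / n ^ 2 * (4 * Real.pi ^ 2 * 1) * (q * (P / ν)) ≤ 1 := by
      have ee : ν / n ^ 2 * (4 * Real.pi ^ 2 * 1) * (q * (P / ν)) = 4 * Real.pi ^ 2 * q * P / n ^ 2 := by field_simp
      rw [ee, div_le_one (by positivity)]; nlinarith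
    have := Real.exp_le_exp.2 h1
    linarith [Real.exp_one_lt_three]
  -- (1) the junk term `B₂ ≤ π⁴ c₀ δ`
  have hB2 : (1 + 1 / (δ / 8)) * (e ^ 2 * cF ^ 2 * (1 + η) * (q * (P / ν)) ^ 2) ≤ Real.pi ^ 4 * c₀ * δ := by
    have h1 : 1 + 1 / (δ / 8) ≤ 9 / δ := by
      rw [one_div_div, le_div_iff₀ hδ0, add_mul, div_mul_cancel₀ _ hδ0.ne']
      linarith
    have hcF2 : cF ^ 2 ≤ k ^ 2 / n ^ 2 := by
      have := pow_le_pow_left₀ hcF0 hcF 2; rwa [div_pow] at this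
    have he2 : e ^ 2 ≤ 9 := by nlinarith
    have hQ2 : (q * (P / ν)) ^ 2 = q ^ 2 * P ^ 2 / ν ^ 2 := by field_simp
    have hkn : 0 ≤ k ^ 2 / n ^ 2 := by positivity
    have hqp : 0 ≤ q ^ 2 * P ^ 2 / ν ^ 2 := by positivity
    have h2 : e ^ 2 * cF ^ 2 * (1 + η) * (q * (P / ν)) ^ 2 ≤ 9 * (k ^ 2 / n ^ 2) * 2 * (q ^ 2 * P ^ 2 / ν ^ 2) := by
      rw [hQ2]
      have h3 : e ^ 2 * cF ^ 2 ≤ 9 * (k ^ 2 / n ^ 2) := mul_le_mul he2 hcF2 (sq_nonneg _) (by norm_num)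
      have h4 : e ^ 2 * cF ^ 2 * (1 + η) ≤ 9 * (k ^ 2 / n ^ 2) * 2 := by
        nlinarith [mul_le_mul_of_nonneg_right h3 (by linarith : (0:ℝ) ≤ 1 + η),
          mul_le_mul_of_nonneg_left (by linarith : 1 + η ≤ (2:ℝ)) (by positivity : (0:ℝ) ≤ 9 * (k ^ 2 / n ^ 2))]
      exact mul_le_mul_of_nonneg_right h4 hqp
    have h9 : 0 ≤ 9 / δ := by positivity
    calc (1 + 1 / (δ / 8)) * (e ^ 2 * cF ^ 2 * (1 + η) * (q * (P / ν)) ^ 2)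
        ≤ (9 / δ) * (9 * (k ^ 2 / n ^ 2) * 2 * (q ^ 2 * P ^ 2 / ν ^ 2)) := mul_le_mul h1 h2 (by positivity) h9
      _ = (162 * k ^ 2 * q ^ 2 * P ^ 2) / (δ * ν ^ 2 * n ^ 2) := by field_simp; ring
      _ ≤ (Real.pi ^ 4 * c₀ * δ ^ 2 * ν ^ 2 * n ^ 2) / (δ * ν ^ 2 * n ^ 2) := by gcongr
      _ = Real.pi ^ 4 * c₀ * δ := by field_simp
  -- (2) the main term `B₁ ≤ 16π⁴c₀ + 3π⁴c₀δ`
  have hB1 : (1 + δ / 8) * (32 * Real.pi ^ 4 * c₀ + 3 * (1 / n)) / 2 ≤ 16 * Real.pi ^ 4 * c₀ + 3 * Real.pi ^ 4 * c₀ * δ := by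
    have h1 : 3 * (1 / n) ≤ Real.pi ^ 4 * c₀ * δ := by
      rw [mul_one_div, div_le_iff₀ hn0]; nlinarith
    nlinarith [mul_pos (mul_pos (by positivity : (0:ℝ) < Real.pi ^ 4) hc₀) hδ0]
  have hB : (1 + δ / 8) * (32 * Real.pi ^ 4 * c₀ + 3 * (1 / n)) / 2 +
      (1 + 1 / (δ / 8)) * (e ^ 2 * cF ^ 2 * (1 + η) * (q * (P / ν)) ^ 2) ≤ 16 * Real.pi ^ 4 * c₀ * (1 + δ / 4) := by
    linarith
  -- (3) the geometric factor `1/(1-1/n)² ≤ 1 + 3δ/16`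
  have hX : 1 / (1 - 1 / n) ^ 2 ≤ 1 + 3 * δ / 16 := by
    refine (inv_sq_one_sub_le (by linarith)).trans ?_
    have : 3 / n ≤ 3 * δ / 16 := by
      rw [div_le_iff₀ hn0]
      have := (div_le_iff₀ hδ0).1 hn1
      nlinarith
    linarith
  -- (4) assemble
  have eF : P / ν * 1 / (8 * Real.pi ^ 2 * (ν / n ^ 2) * n ^ 4 * (1 - 1 / n) ^ 2) =
      P / (8 * Real.pi ^ 2 * ν ^ 2 * n ^ 2) * (1 / (1 - 1 / n) ^ 2) := by
    field_simp
  rw [eF]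
  have hc1 : 0 ≤ 4 * (q * (1 - 4 * ρ / 3)) * (P / (8 * Real.pi ^ 2 * ν ^ 2 * n ^ 2)) := by positivity
  have hB0 : 0 ≤ (1 + δ / 8) * (32 * Real.pi ^ 4 * c₀ + 3 * (1 / n)) / 2 +
      (1 + 1 / (δ / 8)) * (e ^ 2 * cF ^ 2 * (1 + η) * (q * (P / ν)) ^ 2) := by positivity
  have hX0' : 0 ≤ 1 / (1 - 1 / n) ^ 2 := by positivity
  calc 4 * (q * (1 - 4 * ρ / 3)) * (P / (8 * Real.pi ^ 2 * ν ^ 2 * n ^ 2) * (1 / (1 - 1 / n) ^ 2)) *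
        ((1 + δ / 8) * (32 * Real.pi ^ 4 * c₀ + 3 * (1 / n)) / 2 +
          (1 + 1 / (δ / 8)) * (e ^ 2 * cF ^ 2 * (1 + η) * (q * (P / ν)) ^ 2))
      = 4 * (q * (1 - 4 * ρ / 3)) * (P / (8 * Real.pi ^ 2 * ν ^ 2 * n ^ 2)) * ((1 / (1 - 1 / n) ^ 2) *
        ((1 + δ / 8) * (32 * Real.pi ^ 4 * c₀ + 3 * (1 / n)) / 2 +
          (1 + 1 / (δ / 8)) * (e ^ 2 * cF ^ 2 * (1 + η) * (q * (P / ν)) ^ 2))) := by ring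
    _ ≤ 4 * (q * (1 - 4 * ρ / 3)) * (P / (8 * Real.pi ^ 2 * ν ^ 2 * n ^ 2)) *
        ((1 + 3 * δ / 16) * (16 * Real.pi ^ 4 * c₀ * (1 + δ / 4))) :=
        mul_le_mul_of_nonneg_left (mul_le_mul hX hB hB0 (by positivity)) hc1
    _ = (8 * Real.pi ^ 2 * q * P / n ^ 2 * ((1 - 4 * ρ / 3) * c₀) / ν ^ 2) * ((1 + 3 * δ / 16) * (1 + δ / 4)) := by
        field_simp; ring
    _ ≤ (8 * Real.pi ^ 2 * q * P / n ^ 2 * ((1 - 4 * ρ / 3) * c₀) / ν ^ 2) * (1 + δ / 2) := by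
        refine mul_le_mul_of_nonneg_left ?_ (by positivity)
        nlinarith
    _ = (1 + δ / 2) * (8 * Real.pi ^ 2 * q * P / n ^ 2 * ((1 - 4 * ρ / 3) * c₀) / ν ^ 2) := by ring

end Summit.AnomalousDissipation.AnomalousDissipation.Theorems.QuasiStaticSolenoidalCellTensorQ.Negative

end
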